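import Summits.CriticalPhenomena.PercolationContinuityZ3.Theorems.PercNearOneGluingNoHeavyLowerTailKnQuestion8CoefficientwiseCoreClassKernelMixBundleTwoCorner
import HarnessLib

/-!
# Boundary inequality on bundles, XI: the canonical slab scheme (maximal freezes) and its structure clause

Support file (`--supports stmt-CriticalPhenomena-4575`, closed), prover `prim-cplus-coupling` (gen 57).  No definitions, no notations, no named facts,
no sorries; standard axioms.  Memo `prim-cplus-coupling/A5-COUPLING-gen56.md` §2.3/§3.8 and `A5-COUPLING-gen57.md` §3.

On an explicit bundle with exactly three threads `t, p, q`, one type, one slab thread `t` and an up-closed (restricted) event `𝒱'`, the CANONICAL slab scheme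
freezes `p` (resp. `q`) iff every source with `t` blue starts red there.  `Coefficientwise.bundle_canonical_slab` packages `bundle_slab_scheme_count` with this
choice: there is a landing set `M` with `#sources ≤ #M`, every `λ ∈ M` is a lifted `L₁`-supply point (`A t ⊆ λ`, pre-lift `λ ∖ A t ∈ 𝒱' ∩ hro`), and — the
clause used by the STRUCTURE THEOREM (memo gen 56 §3.8 (a), (b)) — if another thread `t'` is fully red in some `λ ∈ M` then some source with `t` blue does NOT start
red on `t'` (it is blue-starting or blue there).  No hypothesis on the sources.  Used by THEOREM RS (`…KernelMixBundleRS`).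
[cite: KozmaNitzan2024, Questions 8–9 (§5.5 p. 36) (context); Harris 1960]
-/

namespace Summit.CriticalPhenomena.PercolationContinuityZ3.Theorems

open Finset Literature.Probability.Percolation

namespace Coefficientwise

variable {ι V : Type*}

open Classical in
/-- **Canonical slab scheme and structure clause.**  See the module docstring.  Memo gen 56 §2.3/§3.8, gen 57 §3.
[cite: KozmaNitzan2024, Questions 8–9 (§5.5 p. 36) (context); Harris 1960] -/
theorem bundle_canonical_slab (ends : ι → Sym2 V) (r : ℕ) (L : ℕ → ℕ) (hL : ∀ t, t < r → 1 ≤ L t)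
    (w : ℕ → ℕ → V) (e : ℕ → ℕ → ι) (u b : V)
    (hw0 : ∀ t, t < r → w t 0 = u) (hwL : ∀ t, t < r → w t (L t) = b)
    (harc : ∀ t, t < r → ∀ j, 1 ≤ j → j ≤ L t → ends (e t j) = s(w t (j - 1), w t j))
    (hwinj : ∀ t, t < r → ∀ i j, i ≤ L t → j ≤ L t → w t i = w t j → i = j)
    (hcross : ∀ t t', t < r → t' < r → t ≠ t' → ∀ i j, i ≤ L t → j ≤ L t' → w t i = w t' j → (i = 0 ∧ j = 0) ∨ (i = L t ∧ j = L t'))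
    (A : ℕ → Finset ι) (hA : ∀ t, t < r → ∀ i, i ∈ A t ↔ ∃ j, 1 ≤ j ∧ j ≤ L t ∧ e t j = i)
    (hAdisj : ∀ t t', t < r → t' < r → t ≠ t' → Disjoint (A t) (A t'))
    (E : Finset ι) (hEA : ∀ i, i ∈ E ↔ ∃ t, t < r ∧ i ∈ A t)
    (t p q : ℕ) (ht : t < r) (hp : p < r) (hq : q < r) (htp : t ≠ p) (htq : t ≠ q) (hpq : p ≠ q)
    (hr3 : ∀ t', t' < r → t' = t ∨ t' = p ∨ t' = q)
    (𝒱 : Finset ι → Prop) (hV : ∀ ⦃s t : Finset ι⦄, s ⊆ t → 𝒱 s → 𝒱 t)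
    (ha hb ka kb : Set V → ℝ) (mha : Monotone ha) (mhb : Monotone hb) (mka : Monotone ka) (mkb : Monotone kb)
    (ha01 : ∀ S, ha S = 0 ∨ ha S = 1) (hb01 : ∀ S, hb S = 0 ∨ hb S = 1) (ka01 : ∀ S, ka S = 0 ∨ ka S = 1) (kb01 : ∀ S, kb S = 0 ∨ kb S = 1) :
    ∃ M : Finset (Finset ι),
      ((E.powerset).filter (fun σ => Disjoint (A t) σ ∧ 𝒱 σ ∧
        (b ∈ openCluster (ends '' (↑(E \ σ) : Set ι)) u ∧ b ∉ openCluster (ends '' (↑σ : Set ι)) u) ∧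
        (ha (openCluster (ends '' (↑σ : Set ι)) u) = 1 ∧ hb (openCluster (ends '' (↑(E \ σ) : Set ι)) u) = 0) ∧
        (kb (openCluster (ends '' (↑(E \ σ) : Set ι)) u) = 1 ∧ ka (openCluster (ends '' (↑σ : Set ι)) u) = 0))).card ≤ M.card ∧
      (∀ lam ∈ M, lam ⊆ E ∧ A t ⊆ lam ∧ 𝒱 (lam \ A t) ∧
        (ha (openCluster (ends '' (↑(lam \ A t) : Set ι)) u) = 1 ∧ hb (openCluster (ends '' (↑(E \ (lam \ A t)) : Set ι)) u) = 0) ∧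
        (b ∈ openCluster (ends '' (↑lam : Set ι)) u ∧ b ∉ openCluster (ends '' (↑(E \ lam) : Set ι)) u) ∧
        (ha (openCluster (ends '' (↑lam : Set ι)) u) = 1 ∧ kb (openCluster (ends '' (↑lam : Set ι)) u) = 1 ∧
          hb (openCluster (ends '' (↑(E \ lam) : Set ι)) u) = 0 ∧ ka (openCluster (ends '' (↑(E \ lam) : Set ι)) u) = 0)) ∧
      (∀ lam ∈ M, ∀ t', t' < r → t' ≠ t → A t' ⊆ lam → ∃ σ, σ ⊆ E ∧ Disjoint (A t) σ ∧ e t' 1 ∉ σ ∧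
        (𝒱 σ ∧ (b ∈ openCluster (ends '' (↑(E \ σ) : Set ι)) u ∧ b ∉ openCluster (ends '' (↑σ : Set ι)) u) ∧
        (ha (openCluster (ends '' (↑σ : Set ι)) u) = 1 ∧ hb (openCluster (ends '' (↑(E \ σ) : Set ι)) u) = 0) ∧
        (kb (openCluster (ends '' (↑(E \ σ) : Set ι)) u) = 1 ∧ ka (openCluster (ends '' (↑σ : Set ι)) u) = 0))) := by
  set C : Finset ι → Set V := fun ω => openCluster (ends '' (↑ω : Set ι)) u with hC
  obtain ⟨src, hsrc⟩ : ∃ f : Finset ι → Prop, f = fun σ => 𝒱 σ ∧ (b ∈ C (E \ σ) ∧ b ∉ C σ) ∧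
      (ha (C σ) = 1 ∧ hb (C (E \ σ)) = 0) ∧ (kb (C (E \ σ)) = 1 ∧ ka (C σ) = 0) := ⟨_, rfl⟩
  -- the canonical (maximal) freeze flags
  obtain ⟨SP, hSPd⟩ : ∃ S : Finset ℕ, S = if (∀ σ, σ ⊆ E → Disjoint (A t) σ → src σ → e p 1 ∈ σ) then Finset.Icc 1 (L p - 1) else {0} := ⟨_, rfl⟩
  obtain ⟨SQ, hSQd⟩ : ∃ S : Finset ℕ, S = if (∀ σ, σ ⊆ E → Disjoint (A t) σ → src σ → e q 1 ∈ σ) then Finset.Icc 1 (L q - 1) else {0} := ⟨_, rfl⟩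
  -- `Icc 1 (L - 1) ≠ {0}`
  have icc_ne : ∀ n : ℕ, Finset.Icc 1 (n - 1) ≠ ({0} : Finset ℕ) := by
    intro n h
    have : (0 : ℕ) ∈ Finset.Icc 1 (n - 1) := by rw [h]; exact Finset.mem_singleton_self 0
    rw [Finset.mem_Icc] at this; omega
  have hSP : SP = {0} ∨ SP = Finset.Icc 1 (L p - 1) := by
    rw [hSPd]; split_ifs
    · exact Or.inr rfl
    · exact Or.inl rfl
  have hSQ : SQ = {0} ∨ SQ = Finset.Icc 1 (L q - 1) := by
    rw [hSQd]; split_ifs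
    · exact Or.inr rfl
    · exact Or.inl rfl
  have covP : SP = Finset.Icc 1 (L p - 1) → ∀ σ, σ ⊆ E → Disjoint (A t) σ → src σ → e p 1 ∈ σ := by
    intro hS σ hσ hd hs
    rw [hSPd] at hS
    split_ifs at hS with hall
    · exact hall σ hσ hd hs
    · exact absurd hS.symm (icc_ne (L p))
  have covQ : SQ = Finset.Icc 1 (L q - 1) → ∀ σ, σ ⊆ E → Disjoint (A t) σ → src σ → e q 1 ∈ σ := by
    intro hS σ hσ hd hs
    rw [hSQd] at hS
    split_ifs at hS with hall
    · exact hall σ hσ hd hs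
    · exact absurd hS.symm (icc_ne (L q))
  -- if a thread is not frozen, some source does not start red on it
  have hBP : SP = {0} → ∃ σ, σ ⊆ E ∧ Disjoint (A t) σ ∧ e p 1 ∉ σ ∧ src σ := by
    intro hS
    rw [hSPd] at hS
    split_ifs at hS with hall
    · exact absurd hS (icc_ne (L p))
    · push Not at hall
      obtain ⟨σ, hσ, hd, hs, hn⟩ := hall
      exact ⟨σ, hσ, hd, hn, hs⟩
  have hBQ : SQ = {0} → ∃ σ, σ ⊆ E ∧ Disjoint (A t) σ ∧ e q 1 ∉ σ ∧ src σ := by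
    intro hS
    rw [hSQd] at hS
    split_ifs at hS with hall
    · exact absurd hS (icc_ne (L q))
    · push Not at hall
      obtain ⟨σ, hσ, hd, hs, hn⟩ := hall
      exact ⟨σ, hσ, hd, hn, hs⟩
  have key := bundle_slab_scheme_count ends r L hL w e u b hw0 hwL harc hwinj hcross A hA hAdisj E hEA t p q ht hp hq htp htq hpq 𝒱 hV
    ha hb ka kb mha mhb mka mkb ha01 hb01 ka01 kb01 SP SQ hSP hSQ
    (fun hS σ hσ hd hs => covP hS σ hσ hd (by rw [hsrc]; exact hs)) (fun hS σ hσ hd hs => covQ hS σ hσ hd (by rw [hsrc]; exact hs))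
  refine ⟨_, key, ?_, ?_⟩
  · intro lam hlam
    rw [Finset.mem_filter, Finset.mem_powerset] at hlam
    exact ⟨hlam.1, hlam.2.1, hlam.2.2.1, hlam.2.2.2.1, hlam.2.2.2.2.1, hlam.2.2.2.2.2.1⟩
  · intro lam hlam t' ht' ht't hsub
    rw [Finset.mem_filter, Finset.mem_powerset] at hlam
    obtain ⟨-, -, -, -, -, -, fP, fQ⟩ := hlam
    rcases hr3 t' ht' with rfl | rfl | rfl
    · exact absurd rfl ht't
    · rcases hSP with hS | hS
      · obtain ⟨σ, hσ, hd, hd', hs⟩ := hBP hS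
        exact ⟨σ, hσ, hd, hd', by rw [hsrc] at hs; exact hs⟩
      · exact absurd hsub (fP hS).2
    · rcases hSQ with hS | hS
      · obtain ⟨σ, hσ, hd, hd', hs⟩ := hBQ hS
        exact ⟨σ, hσ, hd, hd', by rw [hsrc] at hs; exact hs⟩
      · exact absurd hsub (fQ hS).2

end Coefficientwise

end Summit.CriticalPhenomena.PercolationContinuityZ3.Theorems
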